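import Literature.MathematicalPhysics.QuantumFieldTheory.Balaban1983to89.Node00.Record13SepBgRowOfClassC1
import Literature.MathematicalPhysics.QuantumFieldTheory.Balaban1983to89.Node00.Record12BgRowMixed

/-!
# NODE 00 (YM-PLAN Track A) — STAGE 13: ROW P11's BODY PER DATUM `(p, n, s, 𝐖)` FROM THE TWO CLASS BOUNDS FOR THAT DATUM — node00-def-P11's PER-DATUM assembly
# `bgRowAtDatum_of_classBoundsC1` (FILE 8 `Record12BgRowMixed` §4) LIFTED TO THE STAGE-13 PARAMETER, AT `θ` AND AT `θ₁₅ᶜᶜ¹ = theta13OfThm1CC1`: THE SUPPORT-FREE, GUARD-FREE SUPPLIER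
# (whatever support ∕ separation ∕ (7)-guard the record's `bg` token ranges over — v1.2 `suppOfRecord₁₃Sep`, v1.3 `suppOfRecord₁₃SepMixed`, … — the guarded row at `θ₁₅ᶜᶜ¹` is
# this per-datum implication restricted to that range, by a one-line `fun`)

Cell `pub-ymgap`, seat `pub-ymgap-node00-def-K0a` (g6), FILE 13d (sequel of 13b `Record13SepBgRowOfClassC1` ∕ 13c `Record13SepInhabitedOfClassC1`).  [15] = [Balaban1985Variational],
[6] = [Balaban1985RegularSpaces], [III] = [Balaban1988Convergent], [I] = [Balaban1987RG1].

WHY PER DATUM (director-ym LINE №142 (S4) «key 13 on `suppOfRecord₁₃SepMixed` from the start»; node00-def-P11 LOCATED-P11-MIXED-SUPPORT: the SUPPORT of record is being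
re-typed with print's (7) guard `Sect2.DataSmall7`, and HYP-AUDIT-13 may add further guards).  FILE 13b's lift consumed node00-def-P11's `bgRowAt_of_classBoundsC1`, whose class
hypotheses and conclusion both range over the WHOLE support `regSuppOfRecord … s` — so a per-datum guard on the support (v1.3) could not be threaded through it.  node00-def-P11's
FILE 8 §4 `bgRowAtDatum_of_classBoundsC1` fixes the datum `𝐖` (the support no longer enters): the row's body at `(s, 𝐖)` ⟸ the two class bounds at `(s, 𝐖)` (each under `𝐖 ∈ solvableDom …`)
+ numerics + (C1)(C2) + no wrapping + the two letters.  Lifting THAT gives a supplier with NO support, NO separation and NO (7)-guard in its statement: for every run `p`, level `n ≤ K`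
in the window with compatible partitions, EVERY sequence `s` and EVERY datum `𝐖`, the two class bounds for `(s, 𝐖)` imply the two memberships for `(s, 𝐖)`.  Every guarded
`bg` token of record — present or future — is then served by restriction (`fun p n hn hw hpc s W hW … => this p n hn hw hpc s W (hclass … hW …) (hclassC1 … hW …) …`), and the K0⁗
socket of the day composes with it in one line (FILE 13c did so for v1.2; the v1.3 corollary follows node00-def-T's `Record13` v1.3 by name).

WHAT THIS FILE PROVES (theorems only; 0 `def`).
* §1 ★ `Stage13Params.bgAtDatum_of_classBoundsC1 (θ) (hθ) (hRz) (hB₃) (hB₃') (hM) (hε0) (hBα) (hsN) (hcB) (hBCM) (hsmallI) (hsmallMS) (hC1) (hletterI) (hletterMS)` :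
  `∀ p n, n ≤ p.K → window → PartCompat₁₃ θ p n → ∀ s 𝐖, (𝐖 ∈ solvableDom … → C⁰(s, 𝐖)) → (𝐖 ∈ solvableDom … → C¹(s, 𝐖)) → ∀ j, 1 ≤ j ≤ n → ∀ X, (I) ∧ (MS)` — the numerics
  letters displayed exactly as in FILE 13b §1.
* §2 ★★★ `bgAtDatum_theta13OfThm1CC1_of_pos (hε hε' hB hB' ha₀ ha₁)` — THE SAME AT `θ₁₅ᶜᶜ¹` WITH NOTHING BUT THE SIGNS AS HYPOTHESES: at the witness of the C¹ route, for every
  run ∕ level ∕ sequence ∕ datum, the two class bounds for that datum imply row P11's body for that datum (every letter by FILE 13b §2).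
* (no §3: restricted to v1.2's range — windowed partition-compatible run, separated `s`, `𝐖 ∈ suppOfRecord₁₃`, `𝐖 ∈ solvableDom` — §2 gives back EXACTLY FILE 13b §3's
  `bgSepAt_theta13OfThm1CC1_of_classBounds` and FILE 13c's ★★★★ `exists_k0Sep_of_classBounds` (their class clauses are already displayed per datum), by
  `fun p n hn hw hpc s hsep W hW => bgAtDatum_theta13OfThm1CC1_of_pos … p n hn hw hpc s W (hclass p n hn hw hpc s hsep W hW) (hclassC1 p n hn hw hpc s hsep W hW)`; the v1.3
  corollary over `suppOfRecord₁₃SepMixed` is the same line once node00-def-T's `Record13` v1.3 is in the tree.)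

HONEST FRAMING.  Composition of tree theorems + index bookkeeping; CONDITIONAL on the two DISPLAYED per-datum class clauses ([15] Thm 1 (8)–(10)'s regularity half for def-R's
background — `Prop` hypotheses, NEVER asserted; node00-def-P11 ∕ dag-n07-e lane supplies them from the fact of record `VariationalThm1RegSepMixed` for (7)-regular data);
nothing of Bałaban asserted; NOT a discharge; K0⁗ NOT closed; counts unmoved (typed 28∕28 · discharged 5∕28); one finite 𝕋⁴ programme at fixed ε — NOT continuum ∕ OS ∕ mass
gap ∕ Clay.  No `sorry`, `axiom`, `def`, `instance`, `notation`.
-/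

noncomputable section

open MeasureTheory
open scoped Matrix.Norms.L2Operator

namespace Literature.MathematicalPhysics.QuantumFieldTheory.Balaban1983to89.Node00

open T4Continuum B14.Eq218Concrete B15DeterminingSets B12RegularSpaces111 B14RegularSpaces234 B14Radii T4AxialGaugeSmallField

/-! ## §1. ★ node00-def-P11's PER-DATUM `bgRowAtDatum_of_classBoundsC1` LIFTED TO THE STAGE-13 PARAMETER (support-free, guard-free; every numerics letter displayed) -/

section LiftDatum

variable {F : T4Family} {N : ℕ} [NeZero N]

/-- **★ ROW P11's BODY PER DATUM AT THE STAGE-13 RECORD, FROM THE TWO CLASS BOUNDS FOR THAT DATUM** — node00-def-P11's `bgRowAtDatum_of_classBoundsC1` at `S := settingOfRecord₁₃ F N θ p`,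
level by level (level `0` vacuous; level `n + 1` after `UbgOfRecord₁₃_succ`), with `b m := B₃·(cR·ε_m)`, `b′ m := B₃′·(cR·ε_m)`, the positivity of the radii from admissibility in
the window and (C2) from the run-level antecedent `PartCompat₁₃ F N θ p n`: for every run `p`, level `n ≤ K` in the window with compatible partitions, EVERY sequence `s` and EVERY
datum `𝐖` — no support membership, no separation, no (7)-guard — the two class bounds for `(s, 𝐖)` (each under `𝐖 ∈ solvableDom …`, the located reading of [15] Thm 1 (8) resp.
(9)–(10) for def-R's background of that datum) imply the two memberships (I) ∧ (MS) for `(s, 𝐖)`.  A REDUCTION — nothing of Bałaban asserted.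
[cite: Balaban1985Variational, Thm 1 (8)–(10) p.279; Balaban1985RegularSpaces, (1.7)–(1.8) p.77; Balaban1988Convergent, (2.10) p.256, (2.27)–(2.28) p.259, (2.34)–(2.41) p.261, p.257; Balaban1987RG1, (1.11)–(1.16) p.262] -/
theorem Stage13Params.bgAtDatum_of_classBoundsC1 (θ : Stage13Params F N) (hθ : θ.Admissible F N) (hRz : θ.Rz = RzOfRecord F N)
    {B₃ B₃' : ℝ} (hB₃ : 0 ≤ B₃) (hB₃' : 0 ≤ B₃') (hM : 0 < θ.τ9.M)
    (hε0 : ∀ (p : B12.RunParams) (n : ℕ), n ≤ p.K → Step.InInterval θ.γ n (gOfRecord₁₃ F N θ p) → ∀ m, m ≤ n → 0 ≤ θ.s2.cR * epsOfRecord θ.ν (gOfRecord₁₃ F N θ p) m)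
    (hBα : ∀ (p : B12.RunParams) (n : ℕ), n ≤ p.K → Step.InInterval θ.γ n (gOfRecord₁₃ F N θ p) → ∀ m, 1 ≤ m → m ≤ n →
      B₃ * (θ.s2.cR * epsOfRecord θ.ν (gOfRecord₁₃ F N θ p) m) ≤ (1 - θ.s2.βc) * (lfOfRecord₁₂ F N θ.toStage12Params).alpha0 (gOfRecord₁₃ F N θ p m))
    (hsN : ∀ (p : B12.RunParams) (n : ℕ), n ≤ p.K → ∀ n', 1 ≤ n' → n' ≤ n + 1 →
      ((B14.Eq213MaximalDomains.side (F.P p.K).L θ.τ9.M n' : ℕ) : ℤ) < (F.P p.K).sitesPerDir 0)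
    (hcB : ∀ p : B12.RunParams, 2 * (((F.P p.K).d - 1 : ℕ) : ℝ) * ((F.P p.K).L * θ.τ9.M) < θ.s2.cB)
    (hBCM : ∀ p : B12.RunParams, 2 * (((F.P p.K).d - 1 : ℕ) : ℝ) * θ.τ9.M < θ.s2.B * θ.s2.C * θ.s2.Mr)
    (hsmallI : ∀ (p : B12.RunParams) (n : ℕ), n ≤ p.K → Step.InInterval θ.γ n (gOfRecord₁₃ F N θ p) → ∀ j, 1 ≤ j → j ≤ n →
      (((F.P p.K).d - 1 : ℕ) : ℝ) * ((F.P p.K).L * θ.τ9.M) * (F.P p.K).eta j * (B₃ * (θ.s2.cR * epsOfRecord θ.ν (gOfRecord₁₃ F N θ p) j)) ≤ 1 / 2)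
    (hsmallMS : ∀ (p : B12.RunParams) (n : ℕ), n ≤ p.K → Step.InInterval θ.γ n (gOfRecord₁₃ F N θ p) → ∀ m, 1 ≤ m → m ≤ n →
      (((F.P p.K).d - 1 : ℕ) : ℝ) * θ.τ9.M * (F.P p.K).eta m * (B₃ * (θ.s2.cR * epsOfRecord θ.ν (gOfRecord₁₃ F N θ p) m)) ≤ 1 / 2)
    (hC1 : ∀ (p : B12.RunParams) (n : ℕ), n ≤ p.K → Step.InInterval θ.γ n (gOfRecord₁₃ F N θ p) → ∀ j, 1 ≤ j → j ≤ n →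
      ∃ t : ℕ, 0 < t ∧ RkOfRecord (F.P p.K).L θ.ν.r (gOfRecord₁₃ F N θ p j) = (F.P p.K).L * t)
    (hletterI : ∀ (p : B12.RunParams) (n : ℕ), n ≤ p.K → Step.InInterval θ.γ n (gOfRecord₁₃ F N θ p) → ∀ j, 1 ≤ j → j ≤ n →
      4 * (B₃ * (θ.s2.cR * epsOfRecord θ.ν (gOfRecord₁₃ F N θ p) j) + (((F.P p.K).d - 1 : ℕ) : ℝ) * (((F.P p.K).L : ℝ) * θ.τ9.M) * (B₃' * (θ.s2.cR * epsOfRecord θ.ν (gOfRecord₁₃ F N θ p) j)) +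
        4 * ((((F.P p.K).d - 1 : ℕ) : ℝ) * (((F.P p.K).L : ℝ) * θ.τ9.M)) ^ 2 * (B₃ * (θ.s2.cR * epsOfRecord θ.ν (gOfRecord₁₃ F N θ p) j)) ^ 2) <
        θ.s2.cB * (lfOfRecord₁₂ F N θ.toStage12Params).alpha0 (gOfRecord₁₃ F N θ p j))
    (hletterMS : ∀ (p : B12.RunParams) (n : ℕ), n ≤ p.K → Step.InInterval θ.γ n (gOfRecord₁₃ F N θ p) → ∀ m, 1 ≤ m → m ≤ n →
      4 * (B₃ * (θ.s2.cR * epsOfRecord θ.ν (gOfRecord₁₃ F N θ p) m) + (((F.P p.K).d - 1 : ℕ) : ℝ) * (θ.τ9.M : ℝ) * (B₃' * (θ.s2.cR * epsOfRecord θ.ν (gOfRecord₁₃ F N θ p) m)) +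
        4 * ((((F.P p.K).d - 1 : ℕ) : ℝ) * (θ.τ9.M : ℝ)) ^ 2 * (B₃ * (θ.s2.cR * epsOfRecord θ.ν (gOfRecord₁₃ F N θ p) m)) ^ 2) <
        rad238 θ.s2.B θ.s2.C θ.s2.Mr ((lfOfRecord₁₂ F N θ.toStage12Params).alpha0 (gOfRecord₁₃ F N θ p m))) :
    ∀ (p : B12.RunParams) (n : ℕ), n ≤ p.K → Step.InInterval θ.γ n (gOfRecord₁₃ F N θ p) → PartCompat₁₃ F N θ p n →
      ∀ (s : SeqOfRecord F θ.ν θ.τ9.M (gOfRecord₁₃ F N θ p) p.K n) (W : MSField (F.P p.K) (SU N)),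
      (W ∈ solvableDom (avOfRecord F N p.K) (regMSOfRecord F N θ.ν p.K n s.Ω) (genSet s.Ω n) →
        ∀ m, m ≤ n → PlaqSmallOn (omegaPlaqs s.Ω m) (B₃ * (θ.s2.cR * epsOfRecord θ.ν (gOfRecord₁₃ F N θ p) m) * (F.P p.K).eta m ^ 2) (UbgMSOfRecord F N θ.ν θ.τ9.M (gOfRecord₁₃ F N θ p) p.K n s W)) →
      (W ∈ solvableDom (avOfRecord F N p.K) (regMSOfRecord F N θ.ν p.K n s.Ω) (genSet s.Ω n) →
        ∀ m, 1 ≤ m → m ≤ n → PlaqC1SmallOn (plaqInside (s.Ω m)) (B₃' * (θ.s2.cR * epsOfRecord θ.ν (gOfRecord₁₃ F N θ p) m) * (F.P p.K).eta m ^ 3) (UbgMSOfRecord F N θ.ν θ.τ9.M (gOfRecord₁₃ F N θ p) p.K n s W)) →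
      ∀ j, 1 ≤ j → j ≤ n → ∀ X : (Sect2.domSys (F.P p.K) θ.τ9.M j).Dom,
      (Sect2.domSites (F.P p.K) θ.τ9.M j X ⊆ s.Λ j →
        Sect2.ofBackgroundC (settingOfRecord₁₃ F N θ p).ι (UbgOfRecord₁₃ F N θ p n s W) ∈
          Sect2.spaceI (settingOfRecord₁₃ F N θ p) (θ.Rz p.K) θ.τ9.M j (Sect2.domSites (F.P p.K) θ.τ9.M j X)
            ((settingOfRecord₁₃ F N θ p).lf.alpha0 ((settingOfRecord₁₃ F N θ p).flow.g j)) ((settingOfRecord₁₃ F N θ p).lf.alpha1 ((settingOfRecord₁₃ F N θ p).flow.g j))) ∧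
      (Sect2.admB (F.P p.K) θ.ν θ.τ9.M (gOfRecord₁₃ F N θ p) s.Ω s.Λ j (Sect2.domSites (F.P p.K) θ.τ9.M j X) = true →
        Sect2.ofBackgroundC (settingOfRecord₁₃ F N θ p).ι (UbgOfRecord₁₃ F N θ p n s W) ∈
          Sect2.spaceMS (settingOfRecord₁₃ F N θ p) (θ.Rz p.K) θ.τ9.M j (Sect2.domSites (F.P p.K) θ.τ9.M j X) s.Ω) := by
  intro p n hn hw hpc
  rw [hRz]
  cases n with
  | zero =>
    intro s W _ _ j h1 hj
    exfalso
    omega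
  | succ n =>
    rw [UbgOfRecord₁₃_succ]
    exact fun s W hc0 hc1 j h1 hj X =>
      bgRowAtDatum_of_classBoundsC1 (settingOfRecord₁₃ F N θ p) rfl rfl (settingOfRecord₁₃_laws F N θ p) (settingOfRecord₁₃_pos F N θ hθ.1.pos p) θ.ν hM p.K (n + 1)
        (b := fun m => B₃ * (θ.s2.cR * epsOfRecord θ.ν (gOfRecord₁₃ F N θ p) m)) (b' := fun m => B₃' * (θ.s2.cR * epsOfRecord θ.ν (gOfRecord₁₃ F N θ p) m))
        (fun m hm => mul_nonneg hB₃ (hε0 p (n + 1) hn hw m hm)) (fun m hm => mul_nonneg hB₃' (hε0 p (n + 1) hn hw m hm)) s W hc0 hc1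
        (fun m _ hm => alphaPos₁₃_of_inInterval hθ hw hm)
        (hBα p (n + 1) hn hw) (hsN p (n + 1) hn) (hcB p) (hBCM p) (hsmallI p (n + 1) hn hw) (hsmallMS p (n + 1) hn hw) (hC1 p (n + 1) hn hw) hpc
        (hletterI p (n + 1) hn hw) (hletterMS p (n + 1) hn hw) j h1 hj X

end LiftDatum

/-! ## §2. ★★★ AT `θ₁₅ᶜᶜ¹`: row P11's body per datum from the two class bounds for that datum — NOTHING BUT THE SIGNS AS HYPOTHESES -/

section AtWitnessDatum

variable {F : T4Family} {N : ℕ} [NeZero N] {ε₀ ε₂₉ B₃ B₃' a₀ a₁ : ℝ}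

/-- **★★★ ROW P11's BODY PER DATUM AT `θ₁₅ᶜᶜ¹ = theta13OfThm1CC1 F N ε₀ ε₂₉ B₃ B₃' a₀ a₁` — THE SUPPORT-FREE, GUARD-FREE SUPPLIER**: under the signs `0 < ε₀`, `0 < ε₂₉`, `0 ≤ B₃`,
`0 ≤ B₃′`, `0 < a₀`, `0 < a₁` ONLY — for every run `p`, level `n ≤ K` in the window with compatible partitions, every sequence `s` and every datum `𝐖`: if def-R's background of
`(s, 𝐖)` has `|U(∂p) − 1| < B₃·cR·ε_m·η_m²` on the plaquettes of `Ω_m` (`m ≤ n`) and covariant adjacent-plaquette differences `< B₃′·cR·ε_m·η_m³` inside `Ω_m` (`1 ≤ m ≤ n`) whenever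
`𝐖` admits a minimiser in print's class, then it lies in `U^c_j(X, α₀, α₁)` for `X ⊆ Λ_j` and in `Ũ^c_j(X)` for admissible `X` (`1 ≤ j ≤ n`) — every numerics letter, (C1), no wrapping
and both C¹-route letters by FILE 13b §2, (C2) from the antecedent.  Every guarded `bg` token of record at `θ₁₅ᶜᶜ¹` is this, restricted to its range.  CONDITIONAL per datum on the two
class bounds; nothing of Bałaban asserted. [cite: Balaban1985Variational, Thm 1 (8)–(10) p.279; Balaban1985RegularSpaces, (1.7)–(1.8) p.77; Balaban1988Convergent, (2.10) p.256, (2.27)–(2.28) p.259, (2.34)–(2.41) p.261, p.257; Balaban1987RG1, (1.11)–(1.16) p.262] -/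
theorem bgAtDatum_theta13OfThm1CC1_of_pos (hε : 0 < ε₀) (hε' : 0 < ε₂₉) (hB : 0 ≤ B₃) (hB' : 0 ≤ B₃') (ha₀ : 0 < a₀) (ha₁ : 0 < a₁) :
    ∀ (p : B12.RunParams) (n : ℕ), n ≤ p.K → Step.InInterval (theta13OfThm1CC1 F N ε₀ ε₂₉ B₃ B₃' a₀ a₁).γ n (gOfRecord₁₃ F N (theta13OfThm1CC1 F N ε₀ ε₂₉ B₃ B₃' a₀ a₁) p) → PartCompat₁₃ F N (theta13OfThm1CC1 F N ε₀ ε₂₉ B₃ B₃' a₀ a₁) p n →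
      ∀ (s : SeqOfRecord F (theta13OfThm1CC1 F N ε₀ ε₂₉ B₃ B₃' a₀ a₁).ν (theta13OfThm1CC1 F N ε₀ ε₂₉ B₃ B₃' a₀ a₁).τ9.M (gOfRecord₁₃ F N (theta13OfThm1CC1 F N ε₀ ε₂₉ B₃ B₃' a₀ a₁) p) p.K n) (W : MSField (F.P p.K) (SU N)),
      (W ∈ solvableDom (avOfRecord F N p.K) (regMSOfRecord F N (theta13OfThm1CC1 F N ε₀ ε₂₉ B₃ B₃' a₀ a₁).ν p.K n s.Ω) (genSet s.Ω n) →
        ∀ m, m ≤ n → PlaqSmallOn (omegaPlaqs s.Ω m) (B₃ * ((theta13OfThm1CC1 F N ε₀ ε₂₉ B₃ B₃' a₀ a₁).s2.cR * epsOfRecord (theta13OfThm1CC1 F N ε₀ ε₂₉ B₃ B₃' a₀ a₁).ν (gOfRecord₁₃ F N (theta13OfThm1CC1 F N ε₀ ε₂₉ B₃ B₃' a₀ a₁) p) m) * (F.P p.K).eta m ^ 2) (UbgMSOfRecord F N (theta13OfThm1CC1 F N ε₀ ε₂₉ B₃ B₃' a₀ a₁).ν (theta13OfThm1CC1 F N ε₀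 ε₂₉ B₃ B₃' a₀ a₁).τ9.M (gOfRecord₁₃ F N (theta13OfThm1CC1 F N ε₀ ε₂₉ B₃ B₃' a₀ a₁) p) p.K n s W)) →
      (W ∈ solvableDom (avOfRecord F N p.K) (regMSOfRecord F N (theta13OfThm1CC1 F N ε₀ ε₂₉ B₃ B₃' a₀ a₁).ν p.K n s.Ω) (genSet s.Ω n) →
        ∀ m, 1 ≤ m → m ≤ n → PlaqC1SmallOn (plaqInside (s.Ω m)) (B₃' * ((theta13OfThm1CC1 F N ε₀ ε₂₉ B₃ B₃' a₀ a₁).s2.cR * epsOfRecord (theta13OfThm1CC1 F N ε₀ ε₂₉ B₃ B₃' a₀ a₁).ν (gOfRecord₁₃ F N (theta13OfThm1CC1 F N ε₀ ε₂₉ B₃ B₃' a₀ a₁) p) m) * (F.P p.K).eta m ^ 3) (UbgMSOfRecord F N (theta13OfThm1CC1 F N ε₀ ε₂₉ B₃ B₃' a₀ a₁).ν (theta13OfThm1CC1 F N ε₀ ε₂₉ B₃ B₃' a₀ a₁).τ9.M (gOfRecord₁₃ F N (theta13OfThm1CC1 F N ε₀ ε₂₉ B₃ B₃' a₀ a₁)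 p) p.K n s W)) →
      ∀ j, 1 ≤ j → j ≤ n → ∀ X : (Sect2.domSys (F.P p.K) (theta13OfThm1CC1 F N ε₀ ε₂₉ B₃ B₃' a₀ a₁).τ9.M j).Dom,
      (Sect2.domSites (F.P p.K) (theta13OfThm1CC1 F N ε₀ ε₂₉ B₃ B₃' a₀ a₁).τ9.M j X ⊆ s.Λ j →
        Sect2.ofBackgroundC (settingOfRecord₁₃ F N (theta13OfThm1CC1 F N ε₀ ε₂₉ B₃ B₃' a₀ a₁) p).ι (UbgOfRecord₁₃ F N (theta13OfThm1CC1 F N ε₀ ε₂₉ B₃ B₃' a₀ a₁) p n s W) ∈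
          Sect2.spaceI (settingOfRecord₁₃ F N (theta13OfThm1CC1 F N ε₀ ε₂₉ B₃ B₃' a₀ a₁) p) ((theta13OfThm1CC1 F N ε₀ ε₂₉ B₃ B₃' a₀ a₁).Rz p.K) (theta13OfThm1CC1 F N ε₀ ε₂₉ B₃ B₃' a₀ a₁).τ9.M j (Sect2.domSites (F.P p.K) (theta13OfThm1CC1 F N ε₀ ε₂₉ B₃ B₃' a₀ a₁).τ9.M j X)
            ((settingOfRecord₁₃ F N (theta13OfThm1CC1 F N ε₀ ε₂₉ B₃ B₃' a₀ a₁) p).lf.alpha0 ((settingOfRecord₁₃ F N (theta13OfThm1CC1 F N ε₀ ε₂₉ B₃ B₃' a₀ a₁) p).flow.g j)) ((settingOfRecord₁₃ F N (theta13OfThm1CC1 F N ε₀ ε₂₉ B₃ B₃' a₀ a₁) p).lf.alpha1 ((settingOfRecord₁₃ F N (theta13OfThm1CC1 F N ε₀ ε₂₉ B₃ B₃' a₀ a₁) p).flow.g j))) ∧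
      (Sect2.admB (F.P p.K) (theta13OfThm1CC1 F N ε₀ ε₂₉ B₃ B₃' a₀ a₁).ν (theta13OfThm1CC1 F N ε₀ ε₂₉ B₃ B₃' a₀ a₁).τ9.M (gOfRecord₁₃ F N (theta13OfThm1CC1 F N ε₀ ε₂₉ B₃ B₃' a₀ a₁) p) s.Ω s.Λ j (Sect2.domSites (F.P p.K) (theta13OfThm1CC1 F N ε₀ ε₂₉ B₃ B₃' a₀ a₁).τ9.M j X) = true →
        Sect2.ofBackgroundC (settingOfRecord₁₃ F N (theta13OfThm1CC1 F N ε₀ ε₂₉ B₃ B₃' a₀ a₁) p).ι (UbgOfRecord₁₃ F N (theta13OfThm1CC1 F N ε₀ ε₂₉ B₃ B₃' a₀ a₁) p n s W) ∈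
          Sect2.spaceMS (settingOfRecord₁₃ F N (theta13OfThm1CC1 F N ε₀ ε₂₉ B₃ B₃' a₀ a₁) p) ((theta13OfThm1CC1 F N ε₀ ε₂₉ B₃ B₃' a₀ a₁).Rz p.K) (theta13OfThm1CC1 F N ε₀ ε₂₉ B₃ B₃' a₀ a₁).τ9.M j (Sect2.domSites (F.P p.K) (theta13OfThm1CC1 F N ε₀ ε₂₉ B₃ B₃' a₀ a₁).τ9.M j X) s.Ω) :=
  (theta13OfThm1CC1 F N ε₀ ε₂₉ B₃ B₃' a₀ a₁).bgAtDatum_of_classBoundsC1 (admissible_theta13OfThm1CC1 F N hε hε' hB hB' ha₀ ha₁) rfl hB hB'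
    (by rw [theta13OfThm1CC1_τ9_M]; exact Nat.one_pos) (hε0_theta13OfThm1CC1 hB hB' ha₀ ha₁) (hBα_theta13OfThm1CC1 hB hB' ha₀.le ha₁.le) hsN_theta13OfThm1CC1 hcB_theta13OfThm1CC1 hBCM_theta13OfThm1CC1
    (hsmallI_theta13OfThm1CC1 hB hB' ha₀ ha₁) (hsmallMS_theta13OfThm1CC1 hB hB' ha₀ ha₁) hC1_theta13OfThm1CC1 (hletterI_theta13OfThm1CC1 hB hB' ha₀ ha₁) (hletterMS_theta13OfThm1CC1 hB hB' ha₀ ha₁)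

end AtWitnessDatum

end Literature.MathematicalPhysics.QuantumFieldTheory.Balaban1983to89.Node00

end
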